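import Summits.AtomisticToContinuum.HydrodynamicLimit.Theorems.AntiMazurCoboundariesCellForecastPressureDecayEnskogObjectsB
import Summits.AtomisticToContinuum.HydrodynamicLimit.Theorems.AntiMazurCoboundariesCellForecastPressureDecayKinematicAssemblyNoCollision
import HarnessLib

/-!
# S2e(A) · the short-time cluster tail, piece 1: removing spheres from a hard-sphere trajectory
# (registered sub-goal `stub_clusterTail_removal` of stub `stub_clusterTail`, crux line
# `enskog-compensator-martingale`, crux `CellForecastPressureDecay`, stmt-AtomisticToContinuum-13915)

The short-time cluster tail `ClusterTail σ` (stub S2e) is proved WITHOUT a cluster expansion, by a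
particle-removal (GNZ-type) charging: a tagged sphere flies freely until its first collision, and until then the
OTHER spheres follow the hard-sphere flow of their own initial data — so the event "the tagged sphere collides in
the slab" is charged to a static event of the tagged sphere's initial datum RELATIVE TO THE TRAJECTORY OF THE
OTHERS, whose law is the cell law with one sphere less. This file proves the deterministic input, a LOCAL forward
uniqueness theorem for hard-sphere trajectories (`IsHardSphereTrajectory`, any geometry with continuous
translations over a Hausdorff position space):

* `comp_eq_of_closed` — if the range of an injection of labels `f` is closed under the collisions of a trajectory
  `γ` at the times of `(t₀, T)`, then `γ s ∘ f` agrees on `[t₀, T)` with every trajectory `η` of the sub-system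
  started from `γ t₀ ∘ f` (first-disagreement-time argument of `IsHardSphereTrajectory.unique_holds`: positions
  are continuous; at a collision time of `η` the same pair collides in `γ` from the same left limit; otherwise
  both are free flights of non-participating spheres, `apply_eq_freeFlight_of_forall_not_participates`);
* `removeNth_eq_of_forall_not_participates` (one non-participating sphere, `f = j.succAbove`) and
  `comp_eq_of_isolated` (an isolated pair, `range f = {i, j}ᶜ`);
* `stub_clusterTail_removal` — the registered form along the whole-cell Euclidean flows `Ψ (m+1)`, `Ψ N` / `Ψ m`.

References: Gallagher–Saint-Raymond–Texier 2013, §4.1 (Def. 4.1.2, Prop. 4.1.1: the dynamics is deterministic away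
from grazing and multiple collisions); Cercignani–Illner–Pulvirenti 1994, App. 4.A.
-/

noncomputable section

open MeasureTheory ProbabilityTheory Set Filter Topology
open scoped ENNReal BigOperators InnerProductSpace
open Literature.Analysis.FluidPDE Literature.MathematicalPhysics.KineticTheory

namespace Summit.AtomisticToContinuum.HydrodynamicLimit.Theorems.EnskogCompensator

/-! ## Restricting a configuration to a subset of labels -/

section Restrict

variable {d : Type*} [Fintype d] {X : Type*} {N m : ℕ} {G : Geometry d X} {ε : ℝ}

/-- Restricting to the labels in the range of an injection preserves the hard-sphere domain. [folklore] -/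
theorem comp_mem_hardSphereDomain {f : Fin m → Fin N} (hf : Function.Injective f) {z : Config N d X}
    (hz : z ∈ hardSphereDomain G N ε) : (fun c => z (f c)) ∈ hardSphereDomain G m ε :=
  fun a b hab => hz (f a) (f b) (hf.ne hab)

/-- Contact of the restricted configuration is contact of the corresponding labels. [folklore] -/
theorem comp_mem_contactSet_iff {f : Fin m → Fin N} (hf : Function.Injective f) {z : Config N d X}
    (hz : z ∈ hardSphereDomain G N ε) {a b : Fin m} :
    (fun c => z (f c)) ∈ contactSet G m ε a b ↔ z ∈ contactSet G N ε (f a) (f b) := by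
  simp only [mem_contactSet, comp_mem_hardSphereDomain hf hz, hz, true_and]

/-- The elastic jump of a pair commutes with the restriction to the labels of an injection. [folklore] -/
theorem collidePair_comp_injective {f : Fin m → Fin N} (hf : Function.Injective f) {a b : Fin m}
    (hab : a ≠ b) (z : Config N d X) :
    (fun c => collidePair G (f a) (f b) z (f c)) = collidePair G a b (fun c => z (f c)) := by
  funext c
  by_cases hcb : c = b
  · subst hcb
    rw [collidePair_apply_right, collidePair_apply_right]
  by_cases hca : c = a
  · subst hca
    rw [collidePair_apply_left (hf.ne hab), collidePair_apply_left hab]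
  · rw [collidePair_apply_of_ne (hf.ne hca) (hf.ne hcb), collidePair_apply_of_ne hca hcb]

/-- Free flight commutes with restriction. [folklore] -/
theorem freeFlight_comp (f : Fin m → Fin N) (t : ℝ) (z : Config N d X) :
    (fun c => freeFlight G t z (f c)) = freeFlight G t (fun c => z (f c)) := rfl

/-- A participating particle lies on a collision time. [folklore] -/
theorem mem_collisionTimes_of_participates {γ : ℝ → Config N d X} {t : ℝ} {k : Fin N}
    (h : Participates G ε (γ t) k) : t ∈ collisionTimes G ε γ :=
  mem_collisionTimes_iff_exists_participates.2 ⟨k, h⟩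

end Restrict

/-! ## Removal of a collision-closed group of labels: local forward uniqueness -/

section Removal

variable {d : Type*} [Fintype d] {X : Type*} [TopologicalSpace X] [T2Space X] {N m : ℕ}
  {G : Geometry d X} {ε : ℝ}

/-- **Removal of particles (local forward uniqueness).** Let `γ` be a hard-sphere trajectory of `N` spheres
and `f : Fin m → Fin N` an injection whose range is closed under the collisions of `γ` at the times of
`(t₀, T)` (every colliding pair lies inside or outside the range). If `η` is a hard-sphere trajectory of `m`
spheres with `η t₀ = γ t₀ ∘ f`, then `γ s ∘ f = η s` for all `s ∈ [t₀, T)`: the spheres labelled by the range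
of `f` do not feel the others before `T`. (First-disagreement-time argument of the forward uniqueness of
hard-sphere trajectories.) [cite: GST2013, §4.1] -/
theorem comp_eq_of_closed (hG : ∀ x : X, Continuous (G.translate x)) {f : Fin m → Fin N}
    (hf : Function.Injective f) {γ : ℝ → Config N d X} {η : ℝ → Config m d X}
    (hγ : IsHardSphereTrajectory G ε N γ) (hη : IsHardSphereTrajectory G ε m η) {t₀ T : ℝ}
    (h0 : (fun c => γ t₀ (f c)) = η t₀)
    (hcl : ∀ s ∈ Ioo t₀ T, ∀ p q : Fin N, p ≠ q → γ s ∈ contactSet G N ε p q →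
      (p ∈ Set.range f ↔ q ∈ Set.range f)) :
    ∀ s ∈ Ico t₀ T, (fun c => γ s (f c)) = η s := by
  classical
  -- the restricted curve
  set γf : ℝ → Config m d X := fun s c => γ s (f c) with hγf
  have hcomp : Continuous fun z : Config N d X => (fun c => z (f c) : Config m d X) :=
    continuous_pi fun c => continuous_apply (f c)
  -- a participation of a range label inside `(t₀, T)` is a contact of two range labels
  have hpart : ∀ s ∈ Ioo t₀ T, ∀ c, Participates G ε (γ s) (f c) →
      ∃ a b : Fin m, a ≠ b ∧ γ s ∈ contactSet G N ε (f a) (f b) := by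
    rintro s hs c ⟨q, hcq | hqc⟩
    · have hm := mem_contactPairs.1 hcq
      obtain ⟨c', rfl⟩ := (hcl s hs _ _ hm.1 hm.2).1 ⟨c, rfl⟩
      exact ⟨c, c', fun h => hm.1 (congrArg f h), hm.2⟩
    · have hm := mem_contactPairs.1 hqc
      obtain ⟨c', rfl⟩ := (hcl s hs _ _ hm.1 hm.2).2 ⟨c, rfl⟩
      exact ⟨c', c, fun h => hm.1 (congrArg f h), hm.2⟩
  by_contra hne
  push Not at hne
  obtain ⟨t₁, ht₁, hne₁⟩ := hne
  set S : Set ℝ := {t | t₀ ≤ t ∧ t < T ∧ γf t ≠ η t} with hS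
  have hSne : S.Nonempty := ⟨t₁, ht₁.1, ht₁.2, hne₁⟩
  have hSbdd : BddBelow S := ⟨t₀, fun t ht => ht.1⟩
  set τ := sInf S with hτ
  have hτ₀ : t₀ ≤ τ := le_csInf hSne fun t ht => ht.1
  have hτT : τ < T := (csInf_le hSbdd ⟨ht₁.1, ht₁.2, hne₁⟩).trans_lt ht₁.2
  have hagree : ∀ t, t₀ ≤ t → t < τ → γf t = η t := fun t h1 h2 => by
    by_contra hne'
    exact (lt_irrefl t) (h2.trans_le (csInf_le hSbdd ⟨h1, h2.trans hτT, hne'⟩))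
  -- Step A: agreement at `τ`
  have hA : γf τ = η τ := by
    rcases hτ₀.eq_or_lt with heq | hlt
    · rw [← heq]; exact h0
    have hτI : τ ∈ Ioo t₀ T := ⟨hlt, hτT⟩
    have hev : γf =ᶠ[𝓝[<] τ] η := by
      filter_upwards [Ioo_mem_nhdsLT hlt] with t ht
      exact hagree t ht.1.le ht.2
    -- positions agree at `τ`
    have hpos : ∀ c, (γ τ (f c)).1 = (η τ c).1 := by
      intro c
      have hc : Tendsto (fun t => (γ t (f c)).1) (𝓝[<] τ) (𝓝 (γ τ (f c)).1) :=
        ((hγ.pos_continuous (f c)).tendsto τ).mono_left nhdsWithin_le_nhds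
      have hc' : Tendsto (fun t => (η t c).1) (𝓝[<] τ) (𝓝 (η τ c).1) :=
        ((hη.pos_continuous c).tendsto τ).mono_left nhdsWithin_le_nhds
      have heq : (fun t => (γ t (f c)).1) =ᶠ[𝓝[<] τ] fun t => (η t c).1 := by
        filter_upwards [hev] with t ht
        change (γf t c).1 = (η t c).1
        rw [ht]
      exact tendsto_nhds_unique (hc.congr' heq) hc'
    have hposf : ∀ c, (γf τ c).1 = (η τ c).1 := hpos
    by_cases hcol : τ ∈ collisionTimes G ε η
    · -- a collision of `η` at `τ`: the same pair collides in `γ`, same left limit, same outcome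
      obtain ⟨a, b, hab, hct⟩ := hcol
      have hctf : γf τ ∈ contactSet G m ε a b := (mem_contactSet_congr_fst hposf).2 hct
      have hct' : γ τ ∈ contactSet G N ε (f a) (f b) := (comp_mem_contactSet_iff hf (hγ.mem τ)).1 hctf
      obtain ⟨-, zl, hzl, -, hγe⟩ := hγ.binary τ (f a) (f b) (hf.ne hab) hct'
      obtain ⟨-, zl', hzl', -, hηe⟩ := hη.binary τ a b hab hct
      have hlim : Tendsto γf (𝓝[<] τ) (𝓝 (fun c => zl (f c))) := (hcomp.tendsto zl).comp hzl
      have hzz : (fun c => zl (f c)) = zl' := tendsto_nhds_unique hlim (hzl'.congr' hev.symm)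
      change (fun c => γ τ (f c)) = η τ
      rw [hγe, hηe, collidePair_comp_injective hf hab, hzz]
    · -- no collision of `η` at `τ`: both restricted curves are free flights from a time `s < τ`
      obtain ⟨sγ, hsγ, hfreeγ⟩ := hγ.exists_Ioo_left_free τ
      obtain ⟨sη, hsη, hfreeη⟩ := hη.exists_Ioo_left_free τ
      set s := max (max sγ sη) t₀ with hs
      have hsτ : s < τ := max_lt (max_lt hsγ hsη) hlt
      have hs₀ : t₀ ≤ s := le_max_right _ _
      have hag : γf s = η s := hagree s hs₀ hsτ
      have hηfree : ∀ u ∈ Ioc s τ, u ∉ collisionTimes G ε η := by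
        intro u hu
        rcases hu.2.eq_or_lt with rfl | hlt'
        · exact hcol
        · exact hfreeη u ⟨((le_max_right _ _).trans (le_max_left _ _)).trans_lt hu.1, hlt'⟩
      have hηeq : η τ = freeFlight G (τ - s) (η s) := hη.free s τ hsτ.le hηfree
      -- no range label participates in `γ` on `(s, τ]`
      have hnp : ∀ c, ∀ u ∈ Ioc s τ, ¬ Participates G ε (γ u) (f c) := by
        intro c u hu hp
        rcases hu.2.eq_or_lt with hueq | hlt'
        · rw [hueq] at hp
          obtain ⟨a, b, hab, hc⟩ := hpart _ hτI c hp
          have hctf : γf τ ∈ contactSet G m ε a b := (comp_mem_contactSet_iff hf (hγ.mem τ)).2 hc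
          exact hcol ⟨a, b, hab, (mem_contactSet_congr_fst hposf).1 hctf⟩
        · exact hfreeγ u ⟨((le_max_left _ _).trans (le_max_left _ _)).trans_lt hu.1, hlt'⟩
            (mem_collisionTimes_of_participates hp)
      have hγeq : γf τ = freeFlight G (τ - s) (γf s) := by
        funext c
        change γ τ (f c) = freeFlight G (τ - s) (γ s) (f c)
        rw [apply_eq_freeFlight_of_forall_not_participates hγ hG hsτ.le (hnp c), freeFlight_apply]
      rw [hγeq, hηeq, hag]
  -- Step B: agreement on a right neighbourhood of `τ`
  obtain ⟨δ, hδ, hB⟩ : ∃ δ > 0, ∀ t, τ < t → t < τ + δ → γf t = η t := by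
    obtain ⟨uγ, huγ, hfreeγ⟩ := hγ.exists_Ioo_right_free τ
    obtain ⟨uη, huη, hfreeη⟩ := hη.exists_Ioo_right_free τ
    refine ⟨min (uγ - τ) (uη - τ), lt_min (sub_pos.2 huγ) (sub_pos.2 huη), fun t h1 h2 => ?_⟩
    have htγ : t < uγ := by linarith [min_le_left (uγ - τ) (uη - τ)]
    have htη : t < uη := by linarith [min_le_right (uγ - τ) (uη - τ)]
    have h1' : γ t = freeFlight G (t - τ) (γ τ) :=
      hγ.free τ t h1.le fun u hu => hfreeγ u ⟨hu.1, hu.2.trans_lt htγ⟩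
    have h2' : η t = freeFlight G (t - τ) (η τ) :=
      hη.free τ t h1.le fun u hu => hfreeη u ⟨hu.1, hu.2.trans_lt htη⟩
    change (fun c => γ t (f c)) = η t
    rw [h1', h2', freeFlight_comp, ← hA]
  -- Step C: `τ + δ` is a lower bound of the disagreement set
  have hle : min (τ + δ) T ≤ τ := by
    refine le_csInf hSne fun t ht => ?_
    by_contra hlt
    push Not at hlt
    have hτt : τ ≤ t := csInf_le hSbdd ht
    rcases hτt.eq_or_lt with heq | hlt'
    · exact ht.2.2 (heq ▸ hA)
    · exact ht.2.2 (hB t hlt' (lt_of_lt_of_le hlt (min_le_left _ _)))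
  have := lt_min (by linarith : τ < τ + δ) hτT
  linarith

/-- **Removing one non-participating sphere.** If sphere `j` takes part in no collision of `γ` at the times
of `(t₀, T)` and `η` is a hard-sphere trajectory of the other spheres with `η t₀ = γ t₀ ∘ j.succAbove`, then
`γ s ∘ j.succAbove = η s` on `[t₀, T)`. [cite: GST2013, §4.1] -/
theorem removeNth_eq_of_forall_not_participates (hG : ∀ x : X, Continuous (G.translate x))
    {γ : ℝ → Config (m + 1) d X} {η : ℝ → Config m d X}
    (hγ : IsHardSphereTrajectory G ε (m + 1) γ) (hη : IsHardSphereTrajectory G ε m η) (j : Fin (m + 1))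
    {t₀ T : ℝ} (h0 : (fun c => γ t₀ (j.succAbove c)) = η t₀)
    (hj : ∀ s ∈ Ioo t₀ T, ¬ Participates G ε (γ s) j) :
    ∀ s ∈ Ico t₀ T, (fun c => γ s (j.succAbove c)) = η s := by
  refine comp_eq_of_closed hG Fin.succAbove_right_injective hγ hη h0 fun s hs p q hpq hc => ?_
  rw [Fin.range_succAbove]
  have hp : p ≠ j := by
    rintro rfl
    exact hj s hs ⟨q, Or.inl (mem_contactPairs.2 ⟨hpq, hc⟩)⟩
  have hq : q ≠ j := by
    rintro rfl
    exact hj s hs ⟨p, Or.inr (mem_contactPairs.2 ⟨hpq, hc⟩)⟩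
  simp [hp, hq]

/-- **Removing an isolated pair.** If on `(t₀, T)` every collision of `i` is with `j` and every collision of
`j` is with `i`, and `f` is an injection with range `{i, j}ᶜ`, then `γ s ∘ f = η s` on `[t₀, T)` for every
hard-sphere trajectory `η` of the other spheres with `η t₀ = γ t₀ ∘ f`. [cite: GST2013, §4.1] -/
theorem comp_eq_of_isolated (hG : ∀ x : X, Continuous (G.translate x)) {f : Fin m → Fin N}
    (hf : Function.Injective f) {i j : Fin N} (hrange : Set.range f = {i, j}ᶜ)
    {γ : ℝ → Config N d X} {η : ℝ → Config m d X}
    (hγ : IsHardSphereTrajectory G ε N γ) (hη : IsHardSphereTrajectory G ε m η) {t₀ T : ℝ}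
    (h0 : (fun c => γ t₀ (f c)) = η t₀)
    (hi : ∀ s ∈ Ioo t₀ T, ∀ k, Collide G ε (γ s) i k → k = j)
    (hj : ∀ s ∈ Ioo t₀ T, ∀ k, Collide G ε (γ s) j k → k = i) :
    ∀ s ∈ Ico t₀ T, (fun c => γ s (f c)) = η s := by
  refine comp_eq_of_closed hG hf hγ hη h0 fun s hs p q hpq hc => ?_
  rw [hrange]
  simp only [Set.mem_compl_iff, Set.mem_insert_iff, Set.mem_singleton_iff, not_or]
  have hpq' : (p, q) ∈ contactPairs G ε (γ s) := mem_contactPairs.2 ⟨hpq, hc⟩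
  constructor
  · rintro ⟨hpi, hpj⟩
    refine ⟨fun hqi => ?_, fun hqj => ?_⟩
    · exact hpj (hi s hs p (hqi ▸ Or.inr hpq'))
    · exact hpi (hj s hs p (hqj ▸ Or.inr hpq'))
  · rintro ⟨hqi, hqj⟩
    refine ⟨fun hpi => ?_, fun hpj => ?_⟩
    · exact hqj (hi s hs q (hpi ▸ Or.inl hpq'))
    · exact hqi (hj s hs q (hpj ▸ Or.inl hpq'))

end Removal

/-! ## The registered sub-goal: removal of spheres along the whole-cell flows of the line -/

/-- **Registered sub-goal `stub_clusterTail_removal`** (piece of stub `stub_clusterTail`, S2e, of the line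
`enskog-compensator-martingale`): **a sphere does not feel the others before its first collision, and an isolated
pair does not feel the others before its first collision with a third sphere.** Along the whole-cell flow
`(Ψ (m+1)).flow` of a good datum `z` whose restriction to the labels `≠ j` is a good datum of `Ψ m`: if `j` takes part
in no collision at the times of `(0, T)`, then on `[0, T)` the other spheres follow the `m`-sphere flow of their own
initial data; and the same for the spheres other than an isolated pair `{i, j}` of `(0, T)` along any injection `f`
with range `{i, j}ᶜ` (local forward uniqueness of hard-sphere trajectories: the input of the particle-removal
charging of the short-time cluster tail). [cite: GST2013, §4.1] -/
theorem stub_clusterTail_removal : ∀ (σ : ℝ) (m : ℕ) (Ψ : Flows σ) (T : ℝ),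
    (∀ (z : Cell (m + 1)) (j : Fin (m + 1)), z ∈ (Ψ (m + 1)).good → (fun c => z (j.succAbove c)) ∈ (Ψ m).good →
      (∀ s ∈ Set.Ioo 0 T, ¬ Participates (Euclidean.geometry (Fin 3)) σ ((Ψ (m + 1)).flow s z) j) →
        ∀ s ∈ Set.Ico 0 T, (fun c => (Ψ (m + 1)).flow s z (j.succAbove c)) = (Ψ m).flow s (fun c => z (j.succAbove c))) ∧
    (∀ (N : ℕ) (z : Cell N) (f : Fin m → Fin N) (i j : Fin N), Function.Injective f → Set.range f = {i, j}ᶜ →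
      z ∈ (Ψ N).good → (fun c => z (f c)) ∈ (Ψ m).good →
      (∀ s ∈ Set.Ioo 0 T, ∀ k, Collide (Euclidean.geometry (Fin 3)) σ ((Ψ N).flow s z) i k → k = j) →
      (∀ s ∈ Set.Ioo 0 T, ∀ k, Collide (Euclidean.geometry (Fin 3)) σ ((Ψ N).flow s z) j k → k = i) →
        ∀ s ∈ Set.Ico 0 T, (fun c => (Ψ N).flow s z (f c)) = (Ψ m).flow s (fun c => z (f c))) := by
  intro σ m Ψ T
  refine ⟨fun z j hz hz' hj => ?_, fun N z f i j hf hrange hz hz' hi hj => ?_⟩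
  · refine removeNth_eq_of_forall_not_participates continuous_euclidean_translate ((Ψ (m + 1)).isTrajectory z hz)
      ((Ψ m).isTrajectory _ hz') j ?_ hj
    funext c
    rw [(Ψ (m + 1)).flow_zero z hz, (Ψ m).flow_zero _ hz']
  · refine comp_eq_of_isolated continuous_euclidean_translate hf hrange ((Ψ N).isTrajectory z hz)
      ((Ψ m).isTrajectory _ hz') ?_ hi hj
    funext c
    rw [(Ψ N).flow_zero z hz, (Ψ m).flow_zero _ hz']

end Summit.AtomisticToContinuum.HydrodynamicLimit.Theorems.EnskogCompensator

end
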